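import Summits.QuantumFields.QCD.Theses.NestedDissectionSea
import Literature.MathematicalPhysics.QuantumFieldTheory.QCDPhaseQuenched
import Summits.QuantumFields.QCD.Theorems.ExtinctionBuildsQCD.Negative.WithoutTightCollapse

/-!
# Crux `NegativeCellsDilute` (stmt-QuantumFields-13900), negative side — the gap window

Support file for line `price-the-seed-not-the-spot` (stub C, `stub_sharpCriticalLine`, and stub B,
`stub_parityPinOnLine`, which takes C's GAP clauses as hypotheses).  Stub C asserts, for a witness
regularisation `reg` with `mcrit k → 0`, two phase-quenched spectral events of probability `≥ 7/8`
comparing the smallest singular value `σ(μ)` of the whole-torus Wilson–Dirac matrix `D_W(U, μ, 1)`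
at two probe masses: GAP-UP (`σ(mcrit + a_k M'/Z_m) ≥ σ(mcrit + a_k M/Z_m) + c a_k (M' − M)/Z_m`) and
GAP-DOWN (`σ(mcrit − a_k M'/Z_m) ≥ σ(mcrit − a_k M/Z_m) + c a_k (M' − M)/Z_m`), `M₀ < M < M'`.

Proved here (sorry-free, standard axioms), the spectral twin of `Negative/PinWindow.lean`:

* `sum_norm_sq_wilsonDirac_mulVec_mono` — for EVERY gauge field, `μ ↦ ‖D_W(U, μ, 1) v‖²` is
  non-decreasing on `μ ≥ 0` (Wilson/Seiler positivity `Re⟨v, D_W(U, μ, 1) v⟩ ≥ μ‖v‖²`, tree route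
  `ExtinctionBuildsQCD.Negative.re_star_dotProduct_wilsonDirac_mem`), hence `σ(μ)` is
  non-decreasing on `[0, ∞)`;
* `not_gap_event`, `not_gap_at` — so a gap event asking `σ(μ₂) ≥ σ(μ₁) + t` with
  `0 ≤ μ₂ ≤ μ₁`, `t > 0` is EMPTY for every `U`, its phase-quenched ratio is `0` on every torus,
  at every coupling, for every weight, and `7/8 ≤ ratio` fails DETERMINISTICALLY (no probability
  estimate is involved: one configuration-free argument decides every "high line");
* `gapDown_window` — consequently the GAP-DOWN clause (inlined verbatim, generic `reg`, `m`, `M₀`)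
  forces `mcrit k − a_k M'/Z_m k < 0` for every `M' > M₀`, eventually in `k`
  (`limsup_k mcrit_k Z_m(k)/a_k ≤ M₀`): the witness line of stub C lies in the same window as the
  pin's (`PinWindow.pin_window`), for spectral rather than determinant-sign reasons, and every
  `reg` fed to stub B already satisfies the window;
* `gapDown_window_of_stub` — projection from the verbatim text of `stub_sharpCriticalLine`
  (certifies that the inlined clause is the stub's).

What is NOT decided here (and is not decidable from the tree): inside the window both gap events are
non-trivial (the free field `U = 1` satisfies them with `c ≤ 1`, `σ(μ) = |μ|` near `0`; constant
centre-twisted flat fields violate GAP-UP once `2π Z_m(k)/(3 R M) ≫ 1`), and no tree fact bounds the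
phase-quenched `wilsonMeasure`-probability of a non-trivial spectral event of `D_W` at
asymptotically scaling `β_k` from either side.
-/

noncomputable section

namespace Summit.QuantumFields.QCD.Theorems.NegativeCellsDiluteGapWindow

open scoped BigOperators Topology Classical Matrix
open Filter MeasureTheory Matrix
open Literature.MathematicalPhysics.QuantumLattice Literature.MathematicalPhysics.QuantumFieldTheory
  Literature.Probability.LatticeModels
open Summit.QuantumFields.QCD.Theorems.ExtinctionBuildsQCD.Negative
  (re_star_dotProduct_wilsonDirac_mem sum_norm_sq_pos)

/-! ## Pointwise spectral monotonicity on `μ ≥ 0` -/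

/-- `Σ‖a + t v‖² = Σ‖a‖² + 2t Re⟨v, a⟩ + t² Σ‖v‖²` for real `t`. [folklore] -/
theorem sum_norm_sq_add_real_mul {n : Type*} [Fintype n] (a v : n → ℂ) (t : ℝ) :
    ∑ i, ‖a i + (t : ℂ) * v i‖ ^ 2 =
      ∑ i, ‖a i‖ ^ 2 + 2 * t * (star v ⬝ᵥ a).re + t ^ 2 * ∑ i, ‖v i‖ ^ 2 := by
  have key : ∀ i, ‖a i + (t : ℂ) * v i‖ ^ 2 =
      ‖a i‖ ^ 2 + 2 * t * (star (v i) * a i).re + t ^ 2 * ‖v i‖ ^ 2 := by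
    intro i
    simp only [← Complex.normSq_eq_norm_sq, Complex.normSq_apply, Complex.add_re, Complex.add_im,
      Complex.mul_re, Complex.mul_im, Complex.ofReal_re, Complex.ofReal_im, Complex.star_def,
      Complex.conj_re, Complex.conj_im]
    ring
  have hdot : (star v ⬝ᵥ a).re = ∑ i, (star (v i) * a i).re := by
    rw [dotProduct, Complex.re_sum]
    rfl
  rw [hdot, Finset.mul_sum, Finset.mul_sum, ← Finset.sum_add_distrib, ← Finset.sum_add_distrib]
  exact Finset.sum_congr rfl fun i _ => key i

variable {L : ℕ} [NeZero L]

omit [NeZero L] in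
/-- The bare mass enters the Wilson–Dirac matrix through the identity:
`D_W(U, μ', 1) = D_W(U, μ, 1) + (μ' − μ)·1`. [folklore] -/
theorem wilsonDirac_mass_shift (U : GaugeConfig 4 L SU3) (μ μ' : ℝ) :
    wilsonDirac (fundamentalRep (Fin 3)) U μ' 1 =
      wilsonDirac (fundamentalRep (Fin 3)) U μ 1 + ((μ' - μ : ℝ) : ℂ) • (1 : Matrix _ _ ℂ) := by
  have hρ : ∀ g : SU3, fundamentalRep (Fin 3) g ∈ Matrix.unitaryGroup (Fin 3) ℂ :=
    fundamentalRep_mem_unitaryGroup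
  have h : ((μ' + 4 : ℝ) : ℂ) = ((μ + 4 : ℝ) : ℂ) + ((μ' - μ : ℝ) : ℂ) := by
    push_cast; ring
  rw [wilsonDirac_eq_sub_sum_wilsonHop _ hρ U μ', wilsonDirac_eq_sub_sum_wilsonHop _ hρ U μ, h,
    add_smul]
  abel

/-- **Spectral monotonicity on the positive axis (every gauge field).** For `0 ≤ μ ≤ μ'` and every
spinor `v`, `‖D_W(U, μ, 1) v‖² ≤ ‖D_W(U, μ', 1) v‖²`: expand
`‖D(μ')v‖² = ‖D(μ)v‖² + 2(μ'−μ) Re⟨v, D(μ)v⟩ + (μ'−μ)²‖v‖²` and use Wilson positivity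
`Re⟨v, D(μ)v⟩ ≥ μ‖v‖² ≥ 0`.  Hence the smallest singular value of `D_W(U, ·, 1)` is non-decreasing
on `[0, ∞)` for EVERY `U`. [folklore] -/
theorem sum_norm_sq_wilsonDirac_mulVec_mono (U : GaugeConfig 4 L SU3) {μ μ' : ℝ} (hμ : 0 ≤ μ)
    (hμμ' : μ ≤ μ') (v : TorusSite 4 L × Fin 3 × Fin 4 → ℂ) :
    ∑ i, ‖(wilsonDirac (fundamentalRep (Fin 3)) U μ 1 *ᵥ v) i‖ ^ 2 ≤
      ∑ i, ‖(wilsonDirac (fundamentalRep (Fin 3)) U μ' 1 *ᵥ v) i‖ ^ 2 := by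
  have hshift : ∀ i, (wilsonDirac (fundamentalRep (Fin 3)) U μ' 1 *ᵥ v) i =
      (wilsonDirac (fundamentalRep (Fin 3)) U μ 1 *ᵥ v) i + ((μ' - μ : ℝ) : ℂ) * v i := by
    intro i
    rw [wilsonDirac_mass_shift U μ μ', add_mulVec, smul_mulVec, one_mulVec, Pi.add_apply,
      Pi.smul_apply, smul_eq_mul]
  have hre : μ * ∑ i, ‖v i‖ ^ 2 ≤
      (star v ⬝ᵥ (wilsonDirac (fundamentalRep (Fin 3)) U μ 1 *ᵥ v)).re :=
    (re_star_dotProduct_wilsonDirac_mem U μ v).1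
  have hv0 : 0 ≤ ∑ i, ‖v i‖ ^ 2 := Finset.sum_nonneg fun i _ => by positivity
  have hre0 : 0 ≤ (star v ⬝ᵥ (wilsonDirac (fundamentalRep (Fin 3)) U μ 1 *ᵥ v)).re :=
    (mul_nonneg hμ hv0).trans hre
  simp only [hshift]
  rw [sum_norm_sq_add_real_mul]
  nlinarith [mul_nonneg (sub_nonneg.2 hμμ') hre0, mul_nonneg (sq_nonneg (μ' - μ)) hv0]

/-! ## The gap event is empty on a high line -/

/-- **No gap can open downwards above zero.** For probes `0 ≤ μ₂ ≤ μ₁` and an increment `t > 0`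
the event "`σ(μ₂) ≥ τ + t` and `σ(μ₁) ≤ τ` for some `τ ≥ 0`" (`σ` the smallest singular value of
`D_W(U, ·, 1)`, written with test vectors exactly as in the crux line's GAP clauses) holds for NO
gauge field. [folklore] -/
theorem not_gap_event (U : GaugeConfig 4 L SU3) {μ₁ μ₂ t : ℝ} (h₂ : 0 ≤ μ₂) (h₁₂ : μ₂ ≤ μ₁)
    (ht : 0 < t) :
    ¬ (∃ τ : ℝ, 0 ≤ τ ∧ (∃ v : TorusSite 4 L × Fin 3 × Fin 4 → ℂ, v ≠ 0 ∧
        ∑ i, ‖(wilsonDirac (fundamentalRep (Fin 3)) U μ₁ 1 *ᵥ v) i‖ ^ 2 ≤ τ ^ 2 * ∑ i, ‖v i‖ ^ 2) ∧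
      (∀ v : TorusSite 4 L × Fin 3 × Fin 4 → ℂ, (τ + t) ^ 2 * ∑ i, ‖v i‖ ^ 2 ≤
        ∑ i, ‖(wilsonDirac (fundamentalRep (Fin 3)) U μ₂ 1 *ᵥ v) i‖ ^ 2)) := by
  rintro ⟨τ, hτ, ⟨v, hv, hup⟩, hlow⟩
  have hmono := sum_norm_sq_wilsonDirac_mulVec_mono U h₂ h₁₂ v
  have hpos : 0 < ∑ i, ‖v i‖ ^ 2 := sum_norm_sq_pos hv
  have h1 : (τ + t) ^ 2 * ∑ i, ‖v i‖ ^ 2 ≤ τ ^ 2 * ∑ i, ‖v i‖ ^ 2 :=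
    (hlow v).trans (hmono.trans hup)
  have h2 : (τ + t) ^ 2 ≤ τ ^ 2 := le_of_mul_le_mul_right h1 hpos
  nlinarith

/-- Hence on a high line the gap ratio VANISHES — for every odd or even torus, every coupling `β`
and every (phase-quenched or not) weight `wt` — and the crux line's `7/8 ≤ ratio` fails
deterministically. [folklore] -/
theorem not_gap_at {N : ℕ} [NeZero N] (β : ℝ) {μ₁ μ₂ t : ℝ} (h₂ : 0 ≤ μ₂) (h₁₂ : μ₂ ≤ μ₁)
    (ht : 0 < t) (wt : GaugeConfig 4 N SU3 → ℝ) :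
    ¬ ((7 / 8 : ℝ) ≤ (∫ U, (if (∃ τ : ℝ, 0 ≤ τ ∧ (∃ v : TorusSite 4 N × Fin 3 × Fin 4 → ℂ, v ≠ 0 ∧
        ∑ i, ‖(wilsonDirac (fundamentalRep (Fin 3)) U μ₁ 1 *ᵥ v) i‖ ^ 2 ≤ τ ^ 2 * ∑ i, ‖v i‖ ^ 2) ∧
      (∀ v : TorusSite 4 N × Fin 3 × Fin 4 → ℂ, (τ + t) ^ 2 * ∑ i, ‖v i‖ ^ 2 ≤
        ∑ i, ‖(wilsonDirac (fundamentalRep (Fin 3)) U μ₂ 1 *ᵥ v) i‖ ^ 2)) then (1 : ℝ) else 0) * wt U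
          ∂(wilsonMeasure (d := 4) (L := N) (fundamentalRep (Fin 3)) β)) /
      (∫ U, wt U ∂(wilsonMeasure (d := 4) (L := N) (fundamentalRep (Fin 3)) β))) := by
  rw [integral_eq_zero_of_ae (Eventually.of_forall fun U => by
    simp only [Pi.zero_apply]
    rw [if_neg (not_gap_event U h₂ h₁₂ ht), zero_mul]), zero_div]
  norm_num

/-! ## The window the GAP-DOWN clause forces on `reg.mcrit` -/

/-- Once `2 a_k ≤ R` there is an odd torus of physical side in `[R, 2R]`: the GAP clauses are never
vacuous in `S` eventually. [folklore] -/
theorem exists_admissible_S₂ {Nf : ℕ} (reg : QCDRegularisation Nf) {R : ℝ} {k : ℕ}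
    (hR : 2 * reg.a k ≤ R) :
    ∃ S : ℕ, R ≤ reg.a k * (2 * S + 1) ∧ reg.a k * (2 * S + 1) ≤ 2 * R := by
  have ha := reg.a_pos k
  have hx0 : 0 ≤ (R / reg.a k - 1) / 2 := by
    have : 2 ≤ R / reg.a k := by rw [le_div_iff₀ ha]; linarith
    linarith
  have hxa : (R / reg.a k - 1) / 2 * reg.a k = (R - reg.a k) / 2 := by
    field_simp
  refine ⟨⌈(R / reg.a k - 1) / 2⌉₊, ?_, ?_⟩
  · have h1 : (R / reg.a k - 1) / 2 ≤ (⌈(R / reg.a k - 1) / 2⌉₊ : ℝ) := Nat.le_ceil _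
    have h2 := mul_le_mul_of_nonneg_right h1 ha.le
    rw [hxa] at h2
    linarith
  · have h1 : ((⌈(R / reg.a k - 1) / 2⌉₊ : ℕ) : ℝ) < (R / reg.a k - 1) / 2 + 1 :=
      Nat.ceil_lt_add_one hx0
    have h2 := mul_lt_mul_of_pos_right h1 ha
    rw [add_mul, hxa, one_mul] at h2
    linarith

/-- The GAP-DOWN increment is positive. [folklore] -/
theorem gap_increment_pos {Nf : ℕ} (reg : QCDRegularisation Nf) {c M M' : ℝ} (hc : 0 < c)
    (hMM' : M < M') (k : ℕ) : 0 < c * (reg.a k * (M' - M) / reg.Zm k) :=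
  mul_pos hc (div_pos (mul_pos (reg.a_pos k) (by linarith)) (reg.Zm_pos k))

/-- The lower GAP-DOWN probe lies below the upper one. [folklore] -/
theorem probe_le_probe {Nf : ℕ} (reg : QCDRegularisation Nf) {M M' : ℝ} (hMM' : M ≤ M') (k : ℕ) :
    reg.mcrit k - reg.a k * M' / reg.Zm k ≤ reg.mcrit k - reg.a k * M / reg.Zm k := by
  have : reg.a k * M / reg.Zm k ≤ reg.a k * M' / reg.Zm k :=
    div_le_div_of_nonneg_right (mul_le_mul_of_nonneg_left hMM' (reg.a_pos k).le) (reg.Zm_pos k).le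
  linarith

/-- **Gap window.** If the GAP-DOWN clause of `stub_sharpCriticalLine` (inlined VERBATIM, for a
generic regularisation `reg`, sea-mass tuple `m` and threshold `M₀`) holds, then for every
`M' > M₀`, eventually in `k`, the lower probe is negative: `mcrit k − a_k M'/Z_m k < 0`
(`limsup_k mcrit_k Z_m(k)/a_k ≤ M₀`).  Proof: between `M := (M₀ + M')/2` and `M'` the clause yields
a physical size `R`; eventually `2a_k ≤ R`, an admissible odd torus exists, and were the lower probe
`≥ 0` the gap event would be empty (`not_gap_at`), contradicting `7/8 ≤ 0`. [folklore] -/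
theorem gapDown_window {Nf : ℕ} {reg : QCDRegularisation Nf} {m : Fin Nf → ℝ} {M₀ : ℝ}
    (h : ∃ c : ℝ, 0 < c ∧ ∀ M M' : ℝ, M₀ < M → M < M' → ∃ R : ℝ, 0 < R ∧ ∀ᶠ k : ℕ in atTop, ∀ S : ℕ, R ≤ reg.a k * (2 * S + 1) → reg.a k * (2 * S + 1) ≤ 2 * R → let μW := wilsonMeasure (d := 4) (L := 2 * S + 1) (fundamentalRep (Fin 3)) (reg.β k); let wt : GaugeConfig 4 (2 * S + 1) SU3 → ℝ := fun U => ∏ f, ‖fermionDet (wilsonDirac (fundamentalRep (Fin 3)) U (reg.mcrit k + reg.a k * m f / reg.Zm k) 1)‖; 7 / 8 ≤ (∫ U, (if (∃ τ : ℝ, 0 ≤ τ ∧ (∃ v : TorusSite 4 (2 * S + 1) × Fin 3 × Fin 4 → ℂ, v ≠ 0 ∧ ∑ i, ‖(wilsonDirac (fundamentalRep (Fin 3)) U (reg.mcrit k - reg.a k * M / reg.Zm k) 1 *ᵥ v) i‖ ^ 2 ≤ τ ^ 2 * ∑ i, ‖v i‖ ^ 2) ∧ (∀ v : TorusSite 4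 (2 * S + 1) × Fin 3 × Fin 4 → ℂ, (τ + c * (reg.a k * (M' - M) / reg.Zm k)) ^ 2 * ∑ i, ‖v i‖ ^ 2 ≤ ∑ i, ‖(wilsonDirac (fundamentalRep (Fin 3)) U (reg.mcrit k - reg.a k * M' / reg.Zm k) 1 *ᵥ v) i‖ ^ 2)) then (1 : ℝ) else 0) * wt U ∂μW) / (∫ U, wt U ∂μW))
    {M' : ℝ} (hM' : M₀ < M') :
    ∀ᶠ k : ℕ in atTop, reg.mcrit k - reg.a k * M' / reg.Zm k < 0 := by
  obtain ⟨c, hc, h⟩ := h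
  have hM : M₀ < (M₀ + M') / 2 := by linarith
  have hMM' : (M₀ + M') / 2 < M' := by linarith
  obtain ⟨R, hR, hk⟩ := h ((M₀ + M') / 2) M' hM hMM'
  have h2a : ∀ᶠ k : ℕ in atTop, 2 * reg.a k ≤ R := by
    have hev : ∀ᶠ k : ℕ in atTop, reg.a k < R / 2 :=
      reg.tendsto_a (gt_mem_nhds (by positivity : (0 : ℝ) < R / 2))
    filter_upwards [hev] with k hk
    linarith
  filter_upwards [hk, h2a] with k hk h2a
  obtain ⟨S, hS1, hS2⟩ := exists_admissible_S₂ reg h2a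
  have hkS := hk S hS1 hS2
  by_contra hcon
  exact not_gap_at (reg.β k) (not_lt.1 hcon) (probe_le_probe reg hMM'.le k)
    (gap_increment_pos reg hc hMM' k) _ hkS

/-- **Projection from the stub.** The statement of `stub_sharpCriticalLine` (line
`price-the-seed-not-the-spot`, inlined VERBATIM as the hypothesis) confines its own witness line to
the gap window: `∀ M' > M₀, ∀ᶠ k, mcrit k < a_k M'/Z_m k` — every "high line"
(`mcrit k ≥ a_k M'/Z_m k` frequently, for some `M' > M₀`; in particular `mcrit ≡ η > 0`, or
`mcrit_k Z_m(k)/a_k → ∞`) is dead for stub C, deterministically. [folklore] -/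
theorem gapDown_window_of_stub
    (h : ∀ Nf : ℕ, (Nf = 2 ∨ Nf = 3) → ∃ reg : QCDRegularisation Nf, reg.HasMassScaling ∧ (reg.scheme 0 0 0).HasAsymptoticScaling ∧ Tendsto reg.mcrit atTop (𝓝 0) ∧ ∃ M₀ : ℝ, 0 ≤ M₀ ∧ ∀ m : Fin Nf → ℝ, (∀ f, M₀ < m f) → (∃ c : ℝ, 0 < c ∧ ∀ M M' : ℝ, M₀ < M → M < M' → ∃ R : ℝ, 0 < R ∧ ∀ᶠ k : ℕ in atTop, ∀ S : ℕ, R ≤ reg.a k * (2 * S + 1) → reg.a k * (2 * S + 1) ≤ 2 * R → let μW := wilsonMeasure (d := 4) (L := 2 * S + 1) (fundamentalRep (Fin 3)) (reg.β k); let wt : GaugeConfig 4 (2 * S + 1) SU3 → ℝ := fun U => ∏ f, ‖fermionDet (wilsonDirac (fundamentalRep (Fin 3)) U (reg.mcrit k + reg.a k * m f / reg.Zm k) 1)‖; 7 / 8 ≤ (∫ U, (if (∃ τ : ℝ, 0 ≤ τ ∧ (∃ v : TorusSite 4 (2 * S + 1) × Fin 3 × Fin 4 → ℂ, v ≠ 0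 ∧ ∑ i, ‖(wilsonDirac (fundamentalRep (Fin 3)) U (reg.mcrit k + reg.a k * M / reg.Zm k) 1 *ᵥ v) i‖ ^ 2 ≤ τ ^ 2 * ∑ i, ‖v i‖ ^ 2) ∧ (∀ v : TorusSite 4 (2 * S + 1) × Fin 3 × Fin 4 → ℂ, (τ + c * (reg.a k * (M' - M) / reg.Zm k)) ^ 2 * ∑ i, ‖v i‖ ^ 2 ≤ ∑ i, ‖(wilsonDirac (fundamentalRep (Fin 3)) U (reg.mcrit k + reg.a k * M' / reg.Zm k) 1 *ᵥ v) i‖ ^ 2)) then (1 : ℝ) else 0) * wt U ∂μW) / (∫ U, wt U ∂μW)) ∧ (∃ c : ℝ, 0 < c ∧ ∀ M M' : ℝ, M₀ < M → M < M' → ∃ R : ℝ, 0 < R ∧ ∀ᶠ k : ℕ in atTop, ∀ S : ℕ, R ≤ reg.a k * (2 * S + 1) → reg.a k * (2 * S + 1) ≤ 2 * R → let μW := wilsonMeasure (d := 4) (L := 2 * S + 1) (fundamentalRep (Fin 3)) (reg.β k); let wt : GaugeConfig 4 (2 * S + 1) SU3 → ℝ := fun U => ∏ f, ‖fermionDet (wilsonDirac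 (fundamentalRep (Fin 3)) U (reg.mcrit k + reg.a k * m f / reg.Zm k) 1)‖; 7 / 8 ≤ (∫ U, (if (∃ τ : ℝ, 0 ≤ τ ∧ (∃ v : TorusSite 4 (2 * S + 1) × Fin 3 × Fin 4 → ℂ, v ≠ 0 ∧ ∑ i, ‖(wilsonDirac (fundamentalRep (Fin 3)) U (reg.mcrit k - reg.a k * M / reg.Zm k) 1 *ᵥ v) i‖ ^ 2 ≤ τ ^ 2 * ∑ i, ‖v i‖ ^ 2) ∧ (∀ v : TorusSite 4 (2 * S + 1) × Fin 3 × Fin 4 → ℂ, (τ + c * (reg.a k * (M' - M) / reg.Zm k)) ^ 2 * ∑ i, ‖v i‖ ^ 2 ≤ ∑ i, ‖(wilsonDirac (fundamentalRep (Fin 3)) U (reg.mcrit k - reg.a k * M' / reg.Zm k) 1 *ᵥ v) i‖ ^ 2)) then (1 : ℝ) else 0) * wt U ∂μW) / (∫ U, wt U ∂μW))) :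
    ∀ Nf : ℕ, (Nf = 2 ∨ Nf = 3) → ∃ reg : QCDRegularisation Nf, reg.HasMassScaling ∧
      (reg.scheme 0 0 0).HasAsymptoticScaling ∧ Tendsto reg.mcrit atTop (𝓝 0) ∧ ∃ M₀ : ℝ, 0 ≤ M₀ ∧
        ∀ M' : ℝ, M₀ < M' → ∀ᶠ k : ℕ in atTop, reg.mcrit k - reg.a k * M' / reg.Zm k < 0 := by
  intro Nf hNf
  obtain ⟨reg, hms, has, hmc, M₀, hM₀, h⟩ := h Nf hNf
  refine ⟨reg, hms, has, hmc, M₀, hM₀, fun M' hM' => ?_⟩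
  obtain ⟨-, hdown⟩ := h (fun _ => M₀ + 1) (fun _ => by linarith)
  exact gapDown_window hdown hM'

end Summit.QuantumFields.QCD.Theorems.NegativeCellsDiluteGapWindow

end
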